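import Summits.HodgeConjecture.CorCM.MumfordTateRankSevenQuaternionConverse
import Literature.AlgebraicGeometry.HodgeTheory.QuaternionMinimalPowersHodgeClasses
import Literature.NumberTheory.Automorphic.QuaternionDefiniteNorm
import Literature.NumberTheory.Automorphic.QuaternionAlgebraAdelicReducedNormMulProofs
import Literature.NumberTheory.Automorphic.QuaternionAlgebraAdelicNormSqProofs
import Literature.RingTheory.CentralSimple.PositiveInvolutionQuaternionClassification
import Literature.Algebra.Lie.SymplecticAlgebraDimension
import Literature.Algebra.Lie.QuaternionCentralizerSkewDimension
import HarnessLib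

/-!
# The rung `dim MT(H¹(X)) = 7`, CONVERSE of the type-III position: a simple abelian FOURFOLD `B` whose endomorphism
# algebra is a totally definite quaternion algebra over `ℚ` has `dim MT(H¹B) = 7`, and so does every `X ∼ B^{m+1}`

COR-CM (cell `pub-hodgecm2`, seat `b27` gen 44, count-neutral Mumford–Tate-rank ladder; theorems only, no definition, no named
fact; UNCONDITIONAL — nothing here uses or asserts HC_CM).  The lane classified the rung `t := dim MT(H¹X) = 7` with `𝔷 = 0`
into four positions (`CorCM/MumfordTateRankSevenIff` and its predecessors); three of them (split, real multiplication,
quaternion fourfold over a real quadratic field) have converses in the tree, the fourth — Moonen–Zarhin's TYPE III: `X ∼ B^{m+1}`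
with `B` simple, `dim B = 4`, `End⁰B` a definite quaternion algebra over `ℚ` — did not («needs definiteness: type II has
`t = 11`», gen 42).  This file proves it:

* `finrank_hodgeLie_hodge_one_le_six_of_isTotallyDefinite` — **the Lefschetz bound**: for `B` simple of dimension `4` with
  `End⁰B` a totally definite quaternion algebra over `ℚ`, `dim Lie Hg(H¹B) ≤ 6`.  PROOF.  `Lie Hg ⊆ 𝔰𝔭(H¹B, ψ)` and
  `Lie Hg` commutes with `End_Hdg(H¹B) = End⁰(B)^{op}` (Moonen–Zarhin §1: `Hg(X) ⊂ Sp_D(V, φ)`).  The Rosati involution of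
  `ψ` is a positive anti-involution of the first kind on the definite `D = End⁰B`, hence the CANONICAL involution `x ↦ x̄`
  (Lange Thm. 2.6.5 (c), the tree's `isPositiveAntiInvolution_iff_of_isOfFirstKind`), so a quaternion basis `i, j` of
  `D ≅ (a, b / ℚ)` acts on `H¹B` by `ψ`-SKEW anticommuting operators with `i² = a`, `j² = b`.  By
  `Literature/Algebra/Lie/QuaternionCentralizerSkewDimension` (`8 dim C⁻ + 4 dim 𝔰𝔭 = 3 dim End`) and
  `Literature/Algebra/Lie/SymplecticAlgebraDimension` (`dim 𝔰𝔭(H¹B) = 36`): `dim (C_{End}(i, j) ∩ 𝔰𝔭) = 6`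
  — Milne's `dim Sp_D(V, φ) = g²/2 - g/2` for type III with `F = ℚ`, `g = 4`.
* **`mtRank_hodge_one_eq_seven_of_isSimple_fourfold_of_isTotallyDefinite`** — hence **`dim MT(H¹B) = 7`**, no factor of
  type IV, `𝔷 = 0`, not of CM type: `t ≤ 7` by the bound; `t ≥ 4` (not CM), `t ≠ 4` (`dim_ℚ End⁰B = 4 ≠ 16`), `t ∉ {5, 6}` (no
  type IV) by the lower rungs — Moonen–Zarhin 1999 Thm. (0.1) (2), case (c): `Hg(X) = Sp_D(V, φ)`.
* **`mtRank_hodge_one_eq_seven_of_isIsogenous_powSucc_typeThree`** — the same for every `X ∼ B^{m+1}`, with `Lie Hg(H¹X)`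
  `ℚ`-SIMPLE (the split alternative of the rung would make `B` isogenous to a curve or a surface).
So position (a) of the rung `t = 7`, `𝔷 = 0` is now an iff at the level of isogeny shapes in dimension `4`
(forward direction: `CorCM/MumfordTateRankSevenTypeThree{,Isogeny,Factor}`, which leave `(dim B, dim End⁰B) ∈ {(4,4), (8,16)}`).

## References
* [MoonenZarhin1999LowDim] B. Moonen, Yu. Zarhin, *Hodge classes on abelian varieties of low dimension*, Math. Ann. 315 (1999),
  Thm. (0.1) (2) (case (c)) and §1 (`Hg(X) ⊂ Sp_D(V, φ)`).
* [Milne1999LefschetzClasses] J. S. Milne, Duke Math. J. 96 (1999), §2 (type III) and Summary (`dim = g²/2f - g/2`).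
* [Lange2023AbelianVarietiesComplex] H. Lange, *Abelian Varieties over the Complex Numbers* (2023), §2.6.2 Thm. 2.6.5 (c);
  Lange–Birkenhake, *Complex Abelian Varieties*, Prop. 7.2.3 (`Hg ⊆ Sp(V, E)`) and §7.2.4 Ex. (4) (Lefschetz group).
* [MumfordAV1970] D. Mumford, *Abelian Varieties* (1970), §19 Cor. 2, §21 Thm. 2 (type III).
-/

noncomputable section

open scoped TensorProduct Quaternion
open CategoryTheory CategoryTheory.Limits Module

namespace Summit.HodgeConjecture.CorCM

open Literature.AlgebraicGeometry.Motives
open Literature.AlgebraicGeometry.Motives.AbelianVariety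
open Literature.AlgebraicGeometry.Motives.HodgeStructure
open Literature.AlgebraicGeometry.HodgeTheory
open Literature.AlgebraicGeometry.ComplexMultiplication (bettiRep bettiRep_injective isIsogenous_biproduct_powSucc)
open Literature.AlgebraicGeometry.Milne1999 (IsOfCMType)
open Literature.AlgebraicGeometry.Pohlmann1968 (isIsogenous_powSucc_biproduct)
open Literature.NumberTheory.Automorphic (IsQuaternionAlgebra IsTotallyDefinite standardInvolution
  standardInvolution_algEquiv standardInvolution_quaternionAlgebra exists_algEquiv_quaternionAlgebra_of_isTotallyDefinite)
open Literature.RingTheory.CentralSimple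
open Literature.Algebra.Lie
open Summit.HodgeConjecture.CorCM.Domination
open Summit.HodgeConjecture.CorCM.SliceExhaustion (avDominatedBy_prod_left)

variable [HodgeTensorFacts.{0, 0}] {X : AbelianVariety ℂ} {n : ℕ}

/-! ## §1 The Lefschetz bound for type III over `ℚ` in dimension `4`: `dim Lie Hg(H¹B) ≤ 6` -/

/-- **`dim Lie Hg(H¹B) ≤ 6` for a simple abelian fourfold with totally definite quaternion multiplication over `ℚ`.**
`Lie Hg(H¹B)` lies in the Lefschetz Lie algebra `C_{End H¹}(End⁰B) ∩ 𝔰𝔭(H¹B, ψ)`; the Rosati involution is the canonical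
involution of the definite `End⁰B ≅ (a, b / ℚ)`, so `i, j` act by anticommuting `ψ`-skew operators with `i² = a`, `j² = b`,
and the count `8 dim C⁻ + 4 · 36 = 3 · 64` gives `dim C⁻ = 6`. [cite: MoonenZarhin1999LowDim, §1 and Thm. (0.1) (2)]
[cite: Milne1999LefschetzClasses, §2 (type III) and Summary] [cite: Lange2023AbelianVarietiesComplex, §2.6.2 Thm. 2.6.5 (c)] -/
theorem finrank_hodgeLie_hodge_one_le_six_of_isTotallyDefinite {B : AbelianVariety ℂ} {k : ℕ}
    (hB : IsSmoothProjective k B.X) (hBs : B.IsSimple) (hB4 : B.dim = 4) [IsQuaternionAlgebra ℚ B.endAlgebra]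
    (hdef : IsTotallyDefinite ℚ B.endAlgebra) :
    haveI := BettiUniverse.finite hB 1
    Module.finrank ℚ (BettiUniverse.hodge exists_isReal_hodgeModel_holds hB 1).hodgeLie ≤ 6 := by
  classical
  have hk : B.dim = k := schemeDim_eq_holds hB
  subst hk
  haveI := BettiUniverse.finite hB 1
  set H := BettiUniverse.hodge exists_isReal_hodgeModel_holds hB 1 with hH
  have hHD : exists_isReal_hodgeModel := exists_isReal_hodgeModel_holds
  have hI : hodgePQ_independent_of_hodgeModel := hodgePQ_independent_of_hodgeModel_holds
  obtain ⟨ψ⟩ := BettiUniverse.hodge_isPolarizable exists_isReal_hodgeModel_holds hB 1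
  -- the Rosati involution is the canonical involution of the definite quaternion algebra `End⁰B`
  have hD : ∀ x : B.endAlgebra, x ≠ 0 → IsUnit x := fun x hx => (isUnit_or_eq_zero_of_isSimple hBs x).resolve_right hx
  have hA4 : HasNoTypeIVFactor B := AbelianVariety.hasNoTypeIVFactor_of_isTotallyReal (K := ℚ)
  have hpos := AbelianVariety.isPositiveAntiInvolution_rosati (A := B) hHD hI ψ
  have h1 := AbelianVariety.isOfFirstKind_rosati (A := B) hHD hI ψ hA4 (K := ℚ)
  have hros : ∀ x, AbelianVariety.rosati B hHD hI ψ x = standardInvolution ℚ B.endAlgebra x := by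
    obtain ⟨-, h⟩ := (isPositiveAntiInvolution_iff_of_isOfFirstKind ℚ hD h1).mp hpos
    rcases h with ⟨-, h⟩ | ⟨hind, -⟩
    · exact h
    · exact absurd (hind.isSplitAtInfinite Rat.infinitePlace) (hdef Rat.infinitePlace)
  -- a quaternion basis `i, j` of `End⁰B ≅ (a, b / ℚ)`
  obtain ⟨a, b, ha, hb, ⟨e⟩⟩ := exists_algEquiv_quaternionAlgebra_of_isTotallyDefinite B.endAlgebra hdef
  set q := (QuaternionAlgebra.Basis.self ℚ).compHom (e.symm : ℍ[ℚ,a,b] →ₐ[ℚ] B.endAlgebra) with hq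
  have hqi : q.i = e.symm ⟨0, 1, 0, 0⟩ := rfl
  have hqj : q.j = e.symm ⟨0, 0, 1, 0⟩ := rfl
  have hstar_i : standardInvolution ℚ B.endAlgebra q.i = -q.i := by
    rw [hqi, standardInvolution_algEquiv, standardInvolution_quaternionAlgebra, ← map_neg]
    congr 1
    ext <;> simp
  have hstar_j : standardInvolution ℚ B.endAlgebra q.j = -q.j := by
    rw [hqj, standardInvolution_algEquiv, standardInvolution_quaternionAlgebra, ← map_neg]
    congr 1
    ext <;> simp
  -- their images `i', j'` in `End(H¹B)` (Riemann's anti-isomorphism `bettiRep`)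
  let ρ : B.endAlgebra → Module.End ℚ (bettiCohomology B.X 1) := fun z => MulOpposite.unop (bettiRep B z)
  have hρ : ∀ z, ρ z = MulOpposite.unop (bettiRep B z) := fun z => rfl
  have hρmul : ∀ z w, ρ (z * w) = ρ w * ρ z := fun z w => by rw [hρ, map_mul, MulOpposite.unop_mul]
  have hρneg : ∀ z, ρ (-z) = -ρ z := fun z => by rw [hρ, map_neg, MulOpposite.unop_neg]
  have hρsmul : ∀ (c : ℚ) z, ρ (c • z) = c • ρ z := fun c z => by rw [hρ, map_smul, MulOpposite.unop_smul]
  have hρone : ρ 1 = 1 := by rw [hρ, map_one, MulOpposite.unop_one]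
  have hρA : ∀ z, ρ z ∈ H.endAlg := fun z => by
    rw [hρ, hH]
    exact Literature.AlgebraicGeometry.ComplexMultiplication.unop_bettiRep_mem_endAlg hHD hI z
  set i' := ρ q.i with hi'
  set j' := ρ q.j with hj'
  have hii : i' * i' = algebraMap ℚ (Module.End ℚ (bettiCohomology B.X 1)) a := by
    rw [hi', ← hρmul, q.i_mul_i, zero_smul, add_zero, hρsmul, hρone, Algebra.algebraMap_eq_smul_one]
  have hjj : j' * j' = algebraMap ℚ (Module.End ℚ (bettiCohomology B.X 1)) b := by
    rw [hj', ← hρmul, q.j_mul_j, hρsmul, hρone, Algebra.algebraMap_eq_smul_one]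
  have hij : i' * j' = -(j' * i') := by
    rw [hi', hj', ← hρmul, ← hρmul, q.j_mul_i, q.i_mul_j, zero_smul, zero_sub, hρneg]
  -- the adjoint `†` as a linear anti-involution with `i'† = -i'`, `j'† = -j'`
  let τ : Module.End ℚ (bettiCohomology B.X 1) →ₗ[ℚ] Module.End ℚ (bettiCohomology B.X 1) :=
    { toFun := ψ.adjoint, map_add' := ψ.adjoint_add, map_smul' := fun c x => ψ.adjoint_smul c x }
  have hτ : ∀ Y, τ Y = ψ.adjoint Y := fun _ => rfl
  have hτm : ∀ Y Z, τ (Y * Z) = τ Z * τ Y := fun Y Z => by rw [hτ, hτ, hτ, ψ.adjoint_mul]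
  have hττ : ∀ Y, τ (τ Y) = Y := fun Y => by rw [hτ, hτ, ψ.adjoint_adjoint]
  have hτρ : ∀ z, τ (ρ z) = ρ (AbelianVariety.rosati B hHD hI ψ z) := fun z => by
    rw [hτ, hρ, hρ, AbelianVariety.unop_bettiRep_rosati]
  have hτi : τ i' = -i' := by rw [hi', hτρ, hros, hstar_i, hρneg]
  have hτj : τ j' = -j' := by rw [hj', hτρ, hros, hstar_j, hρneg]
  -- `Lie Hg ⊆ C⁻ = C_{End}(i', j') ∩ ker(† + 1)`
  have hle : H.hodgeLie ≤
      Subalgebra.toSubmodule (Subalgebra.centralizer ℚ ({i', j'} : Set (Module.End ℚ (bettiCohomology B.X 1)))) ⊓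
        LinearMap.ker (τ + LinearMap.id) := by
    intro Y hY
    refine Submodule.mem_inf.2 ⟨?_, ?_⟩
    · rw [Subalgebra.mem_toSubmodule, Subalgebra.mem_centralizer_iff]
      intro g hg
      simp only [Set.mem_insert_iff, Set.mem_singleton_iff] at hg
      rcases hg with rfl | rfl
      · exact (commute_of_mem_hodgeLie H hY ⟨i', hρA q.i⟩).symm
      · exact (commute_of_mem_hodgeLie H hY ⟨j', hρA q.j⟩).symm
    · rw [QuaternionCentralizer.mem_ker_add_id_iff, hτ]
      refine (ψ.eq_adjoint_of_isAdjointPair fun v w => ?_).symm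
      rw [LinearMap.neg_apply, map_neg, ← add_eq_zero_iff_eq_neg]
      exact form_apply_add_eq_zero_of_mem_hodgeLie ψ hY v w
  -- the counts: `dim End = 64`, `dim 𝔰𝔭 = 36`, hence `dim C⁻ = 6`
  have hdimV : Module.finrank ℚ (bettiCohomology B.X 1) = 8 := by rw [finrank_bettiCohomology_one_eq_two_mul_dim B, hB4]
  have hE : Module.finrank ℚ (Module.End ℚ (bettiCohomology B.X 1)) = 64 := by rw [Module.finrank_linearMap, hdimV]
  have hflip : ψ.form.flip = -ψ.form := by
    rw [ψ.flip_form, show (((1 : ℕ) : ℤ).negOnePow : ℤˣ) = -1 from Int.negOnePow_one, Units.val_neg, Units.val_one,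
      neg_one_zsmul]
  have hskew : LinearMap.ker (τ + LinearMap.id) = ψ.form.skewAdjointSubmodule := by
    ext Y
    rw [QuaternionCentralizer.mem_ker_add_id_iff, hτ, LinearMap.mem_skewAdjointSubmodule]
    constructor
    · intro h v w
      rw [Pi.neg_apply, ← LinearMap.neg_apply, ← h]
      exact (ψ.form_apply_adjoint Y v w).symm
    · intro h
      refine (ψ.eq_adjoint_of_isAdjointPair fun v w => ?_).symm
      rw [h v w, Pi.neg_apply, LinearMap.neg_apply]
  have h36 : Module.finrank ℚ ↥(LinearMap.ker (τ + LinearMap.id)) = 36 := by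
    have h := SymplecticDimension.two_mul_finrank_skewAdjointSubmodule_of_flip_eq_neg ψ.form ψ.nondegenerate hflip
    rw [hdimV] at h
    rw [hskew]
    omega
  have hcount := QuaternionCentralizer.eight_mul_finrank_centralizer_skew_add (K := ℚ)
    (E := Module.End ℚ (bettiCohomology B.X 1)) ha.ne hb.ne hii hjj hij τ hτm hττ hτi hτj
  rw [h36, hE] at hcount
  have h6 : Module.finrank ℚ
      ↥(Subalgebra.toSubmodule (Subalgebra.centralizer ℚ ({i', j'} : Set (Module.End ℚ (bettiCohomology B.X 1)))) ⊓
        LinearMap.ker (τ + LinearMap.id)) = 6 := by omega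
  exact (Submodule.finrank_mono hle).trans h6.le

/-! ## §2 The rung: `dim MT(H¹B) = 7` -/

/-- **A simple complex abelian FOURFOLD `B` with `End⁰B` a totally definite quaternion algebra over `ℚ` (Albert type III,
`m = 2`) has `dim MT(H¹B) = 7`**, no factor of type IV, `𝔷 = Lie Hg ∩ End_Hdg = 0`, and is not of CM type.  By §1
`t = dim Lie Hg + 1 ≤ 7`; no type IV (centre `ℚ`) ⟹ `t ∉ {5, 6}` and not CM ⟹ `t ≥ 4`; `t = 4` ⟹ `dim_ℚ End⁰B = 16 ≠ 4`.
This is Moonen–Zarhin's «`Hg(X) = Sp_D(V, φ)`» for case (c) of their Theorem (0.1), read through the lane's small-rank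
ladder. [cite: MoonenZarhin1999LowDim, Thm. (0.1) (2) and §1] [cite: Milne1999LefschetzClasses, §2 (type III) and Summary]
[cite: MumfordAV1970, §21 Thm. 2 (type III)] -/
theorem mtRank_hodge_one_eq_seven_of_isSimple_fourfold_of_isTotallyDefinite {B : AbelianVariety ℂ} {k : ℕ}
    (hB : IsSmoothProjective k B.X) (hBs : B.IsSimple) (hB4 : B.dim = 4) [IsQuaternionAlgebra ℚ B.endAlgebra]
    (hdef : IsTotallyDefinite ℚ B.endAlgebra) :
    haveI := BettiUniverse.finite hB 1
    (BettiUniverse.hodge exists_isReal_hodgeModel_holds hB 1).mtRank = 7 ∧ HasNoTypeIVFactor B ∧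
      (BettiUniverse.hodge exists_isReal_hodgeModel_holds hB 1).hodgeLie ⊓
        Subalgebra.toSubmodule (BettiUniverse.hodge exists_isReal_hodgeModel_holds hB 1).endAlg = ⊥ ∧
      ¬ IsOfCMType B := by
  have hk : B.dim = k := schemeDim_eq_holds hB
  subst hk
  haveI := BettiUniverse.finite hB 1
  have hB0 : 0 < B.dim := by omega
  have hE4 : Module.finrank ℚ B.endAlgebra = 4 := IsQuaternionAlgebra.finrank_eq_four (K := ℚ) (D := B.endAlgebra)
  have hA4 : HasNoTypeIVFactor B := AbelianVariety.hasNoTypeIVFactor_of_isTotallyReal (K := ℚ)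
  have hz := hodgeLie_hodge_one_inf_endAlg_eq_bot_of_hasNoTypeIVFactor hB hA4
  have hcm : ¬ IsOfCMType B := not_isOfCMType_of_hasNoTypeIVFactor hB hB0 hA4
  -- `t ≤ 7`
  have h6 := finrank_hodgeLie_hodge_one_le_six_of_isTotallyDefinite hB hBs hB4 hdef
  have ht := mtRank_hodge_one_eq_finrank_hodgeLie_add_one hB hB0
  -- `t ∉ {5, 6}`, `t ≥ 4`, `t ≠ 4`
  obtain ⟨-, -, h5, h6', -⟩ := mtRank_hodge_one_ne_of_hasNoTypeIVFactor hB hB0 hA4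
  have h4 := four_le_mtRank_hodge_one_of_not_isOfCMType hB hcm
  have hne4 : (BettiUniverse.hodge exists_isReal_hodgeModel_holds hB 1).mtRank ≠ 4 := by
    intro h
    obtain ⟨hsq, -, -⟩ := finrank_endAlgebra_eq_dim_sq_of_not_isOfCMType hB hB0 hcm h.le
    rw [hE4, hB4] at hsq
    norm_num at hsq
  refine ⟨?_, hA4, hz, hcm⟩
  omega

/-! ## §3 Powers: `X ∼ B^{m+1}` -/

/-- **Every `X ∼ B^{m+1}` with `B` a simple type-III fourfold over `ℚ` as above has `dim MT(H¹X) = 7`, NO factor of type IV,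
`𝔷 = 0`, is NOT of CM type, and `Lie Hg(H¹X)` is `ℚ`-SIMPLE.**  `dim Lie Hg(H¹X) ≤ dim Lie Hg(H¹B) = 6` (`Hg(Bⁿ) ⊆ Hg(B)`),
`X` inherits «no type IV», `t(X) = 4` would force `dim_ℚ End⁰X = (dim X)² = 16(m+1)²` against `4(m+1)²`; simplicity: the
split alternative `X ∼ B₁^{a+1} × B₂^{b+1}` of the rung has simple factors of dimension `≤ 2`, but the simple `B ≼ X` would be
isogenous to one of them. [cite: MoonenZarhin1999LowDim, Thm. (0.1) (2), §1 and §3 (3.1)]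
[cite: MumfordAV1970, §19 Thm. 1, Cor. 1–2 (pp. 173–174)] -/
theorem mtRank_hodge_one_eq_seven_of_isIsogenous_powSucc_typeThree (hX : IsSmoothProjective n X.X)
    {B : AbelianVariety ℂ} (hBs : B.IsSimple) (hB4 : B.dim = 4) [IsQuaternionAlgebra ℚ B.endAlgebra]
    (hdef : IsTotallyDefinite ℚ B.endAlgebra) {m : ℕ} (hXB : IsIsogenous X (B.powSucc m)) :
    haveI := BettiUniverse.finite hX 1
    letI : LieRing (Module.End ℚ (bettiCohomology X.X 1)) := LieRing.ofAssociativeRing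
    (BettiUniverse.hodge exists_isReal_hodgeModel_holds hX 1).mtRank = 7 ∧ HasNoTypeIVFactor X ∧
      (BettiUniverse.hodge exists_isReal_hodgeModel_holds hX 1).hodgeLie ⊓
        Subalgebra.toSubmodule (BettiUniverse.hodge exists_isReal_hodgeModel_holds hX 1).endAlg = ⊥ ∧
      ¬ IsOfCMType X ∧
      ∀ 𝔏 : LieSubalgebra ℚ (Module.End ℚ (bettiCohomology X.X 1)),
        𝔏.toSubmodule = (BettiUniverse.hodge exists_isReal_hodgeModel_holds hX 1).hodgeLie → LieAlgebra.IsSimple ℚ 𝔏 := by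
  classical
  haveI := BettiUniverse.finite hX 1
  have hsp : ∀ A : AbelianVariety ℂ, IsSmoothProjective A.dim A.X := fun A => AbelianVariety.isSmoothProjective_holds
  haveI := BettiUniverse.finite (hsp B) 1
  have hB0 : 0 < B.dim := by omega
  have hE4 : Module.finrank ℚ B.endAlgebra = 4 := IsQuaternionAlgebra.finrank_eq_four (K := ℚ) (D := B.endAlgebra)
  obtain ⟨h7B, hA4B, -, -⟩ := mtRank_hodge_one_eq_seven_of_isSimple_fourfold_of_isTotallyDefinite (hsp B) hBs hB4 hdef
  -- no type IV for `X`, `𝔷 = 0`, not CM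
  have hA4 : HasNoTypeIVFactor X := hA4B.of_isIsogenous_powSucc hXB
  have hz := hodgeLie_hodge_one_inf_endAlg_eq_bot_of_hasNoTypeIVFactor hX hA4
  have hXP : IsIsogenous X (⨁ fun _ : Fin (m + 1) => B) := hXB.trans (isIsogenous_powSucc_biproduct B m)
  obtain ⟨f, hf⟩ := hXP
  have h0 : 0 < X.dim := by
    rw [dim_eq_of_isIsogeny hf, AndreRiemann.dim_biproduct_const]; positivity
  have hcm : ¬ IsOfCMType X := not_isOfCMType_of_hasNoTypeIVFactor hX h0 hA4
  -- `t(X) ≤ 7`: `dim 𝔥(X) = dim 𝔥(⨁ B) ≤ dim 𝔥(B) = 6`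
  have htB := mtRank_hodge_one_eq_finrank_hodgeLie_add_one (hsp B) hB0
  have h1 := AbelianVariety.finrank_hodgeLie_hodge_one_eq_of_isIsogenous hX (hsp (⨁ fun _ : Fin (m + 1) => B)) ⟨f, hf⟩
  have h2 := AbelianVariety.finrank_hodgeLie_hodge_one_biproduct_const_le (hsp B) (hsp (⨁ fun _ : Fin (m + 1) => B))
    (a := m)
  have ht := mtRank_hodge_one_eq_finrank_hodgeLie_add_one hX h0
  -- `t(X) ∉ {5,6}`, `t(X) ≥ 4`, `t(X) ≠ 4`
  obtain ⟨-, -, h5, h6, -⟩ := mtRank_hodge_one_ne_of_hasNoTypeIVFactor hX h0 hA4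
  have h4 := four_le_mtRank_hodge_one_of_not_isOfCMType hX hcm
  have hne4 : (BettiUniverse.hodge exists_isReal_hodgeModel_holds hX 1).mtRank ≠ 4 := by
    intro h
    obtain ⟨hsq, -, -⟩ := finrank_endAlgebra_eq_dim_sq_of_not_isOfCMType hX h0 hcm h.le
    have hE : Module.finrank ℚ X.endAlgebra = (m + 1) ^ 2 * Module.finrank ℚ B.endAlgebra := by
      rw [IsIsogenous.finrank_endAlgebra_eq ⟨f, hf⟩, EndAlgebraPower.finrank_endAlgebra_biproduct]
    have hd : X.dim = (m + 1) * B.dim := by rw [dim_eq_of_isIsogeny hf, AndreRiemann.dim_biproduct_const]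
    rw [hE, hd, hE4, hB4] at hsq
    have : (m + 1) ^ 2 * 4 = (m + 1) ^ 2 * 16 := by rw [hsq]; ring
    have hpos : 0 < (m + 1) ^ 2 := by positivity
    omega
  have h7 : (BettiUniverse.hodge exists_isReal_hodgeModel_holds hX 1).mtRank = 7 := by omega
  refine ⟨h7, hA4, hz, hcm, ?_⟩
  -- simplicity: the split alternative is excluded
  rcases isSimple_or_exists_isIsogenous_powSucc_prod_powSucc_of_center_eq_bot_of_mtRank_eq_seven hX h0 hz h7 with h | h
  · exact h
  · exfalso
    obtain ⟨B₁, B₂, a, b, hB₁s, hB₂s, hB₁0, hB₁2, hB₂0, hB₂2, -, -, -, -, -, -, -, -, -, ⟨g, hg⟩, -, -⟩ := h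
    obtain ⟨g', hg'⟩ := hXB
    have hdomB : AVDominatedBy B X := (avDominatedBy_powSucc_of_le B (Nat.zero_le m)).trans_isIsogeny_inv hg'
    have hdomP : AVDominatedBy ((B₁.powSucc a).prod (B₂.powSucc b))
        (⨁ AndreRiemann.sumFam (fun _ : Fin (a + 1) => B₁) (fun _ : Fin (b + 1) => B₂)) :=
      AndreRiemann.avDominatedBy_prod_of_biproduct
        (AVDominatedBy.of_isIsogenous (isIsogenous_biproduct_powSucc B₁ a).symm' (AVDominatedBy.refl _))
        (AVDominatedBy.of_isIsogenous (isIsogenous_biproduct_powSucc B₂ b).symm' (AVDominatedBy.refl _))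
    have hsimple' : ∀ j, (AndreRiemann.sumFam (fun _ : Fin (a + 1) => B₁) (fun _ : Fin (b + 1) => B₂) j).IsSimple := by
      rintro (j | j)
      · exact hB₁s
      · exact hB₂s
    obtain ⟨j, hj⟩ := exists_isIsogenous_of_isSimple_of_avDominatedBy_biproduct hsimple' hBs hB0
      ((hdomB.trans_isIsogeny_hom hg).trans hdomP)
    rcases j with j | j
    · have hj' : IsIsogenous B B₁ := hj
      obtain ⟨u, hu⟩ := hj'
      have hd := dim_eq_of_isIsogeny hu
      omega
    · have hj' : IsIsogenous B B₂ := hj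
      obtain ⟨u, hu⟩ := hj'
      have hd := dim_eq_of_isIsogeny hu
      omega

end Summit.HodgeConjecture.CorCM

end
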